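import Literature.NumberTheory.EllipticCurves.Kim2025.LargeImageStructureOPEN
import Literature.NumberTheory.EllipticCurves.BSDSelmerPConverseSerreProofs
import Summits.BirchSwinnertonDyer.Rank1Residual.Additive.X4RankZeroUpperBound
import Summits.BirchSwinnertonDyer.Rank1Residual.Additive.X4SharpThreeAssembly
import Summits.BirchSwinnertonDyer.Rank1Residual.Additive.SemistableTwistTowerThree
import HarnessLib

/-!
# X4♯(3) and the N11 block from ONE announced input: Kim 2025 (arXiv:2505.09121, PREPRINT) at `p = 3`
# under `3`-adic tower surjectivity — the inequality on EVERY tower-surjective row, the reduction of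
# X4♯(3) to the EXOTIC-image rows, and the LOWER half / rank one from ONE unit Kurihara number at `3`
# (cell `b2b-bsdres`, team n1011, seat p09, OWNERS row T-a4)

HONEST FRAMING (cell `b2b-bsdres`, run/shared/lean/b2b/bsd-rank1-residual/, verbatim in every
file): the goal of the cell is to DELETE the COMBINATION-SHAPED residual classes of the
Birch–Swinnerton-Dyer formula for ALL analytic-rank `≤ 1` elliptic curves over `ℚ` — "full BSD
formula for every rank `≤ 1` curve in class `C`" assembled STRICTLY from published theorems — so
that the rank-`≤ 1` remainder becomes exactly the CONSTRUCTION-SHAPED classes, which are TYPED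
(missing-input `Prop`s), NOT attempted. This is not "finishing BSD". Team n1011 (N10/N11, the X4 ∧
`p = 3` additive block) is a RESEARCH ROUTE; no claim beyond the stated classes; the label of X4 and
the §I marks N10/N11 are UNCHANGED by this file; nothing is booked. An ANNOUNCED preprint enters ONLY
as an explicitly labelled OPEN hypothesis: every theorem below carrying `hKim25 : Kim2025.…_OPEN` is
CONDITIONAL on the unrefereed arXiv:2505.09121v1 (C.-H. Kim, *The refined Tamagawa number
conjectures for GL₂*, 2025; its `p = 3` Kolyvagin-system input, Sakamoto JTNB 36 (2024), IS refereed).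
Theorems only (pure compositions; no definition, no named fact minted here). FLAG `Kim2025-preprint`
(referee-1 ACK-1 T-a4, proviso 3) on EVERY theorem below taking a `Kim2025.…_OPEN` binder.

## What this file proves

RESIDUAL-MAP §I N11 = X4 ∧ `r = 0` ∧ `p = 3` ∧ surj(3), "Kim 2026 Thm 1.8 (6) at `p = 3` — not in
print (Kim's argument uses `p ≥ 5`)". The sibling Literature file `Kim2025/LargeImageStructureOPEN`
records that the `p = 3` statement IS ANNOUNCED (Kim 2025 Thm. 1.1 / Thm. 1.2 (rk0) / Cor. 1.7: every
`p ≥ 3`, LARGE `p`-adic image, any reduction at `p`) and types it as three OPEN `Prop`s in the exact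
binder shapes of the published `p ≥ 5` facts, with `ρ̄_{E,p}` onto ↦ `ρ̄_{E,p^n}` onto ∀ `n` (the
cell's TOWER bit: surj(9) / `j`-witness / (ram); automatic at `p ≥ 5` by Serre). Consequences here:

* §1 (every odd `p`, class-agnostic and on X4 ∧ `r_an = 0` ∧ tower): the upper-bound inequality
  `ord_p #Ш ≤ ord_p #Ш_an + ord_p ∏ c_ℓ` from `hKim25` + GZK + modularity, with NO hypothesis on the
  reduction type at `p` (potentially good tame or wild, potentially multiplicative alike), NO
  Tamagawa hypothesis and NO (ram)/Wuthrich binder (`X4RankZero.padicValNat_shaOrder_le_of_kim2025_OPEN`);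
  the typed UPPER half on `p ∤ ∏ c_ℓ` rows; `MissingPPartAt ⟺ MissingLowerBoundAt` there; `BSD(E,p)`
  on the `p ∤ ∏ c_ℓ · #Ш_an` rows.
* §2 (`p = 3`): X4♯(3)'s conclusion on EVERY tower-surjective row — INCLUDING the `3 ∣ ∏ c_ℓ` rows
  (the TAM-DEFECT♭@3 residue of `x4SharpUnitFree_iff_lower_and_residues_sharp`) — and
  **`x4SharpThree_iff_exotic_of_kim2025_OPEN`**: granted `hKim25` (+ GZK + modularity) the conjecture
  `Additive.X4SharpThree` is EQUIVALENT to its restriction to the rows WITHOUT `3`-adic tower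
  surjectivity (the EXOTIC Elkies-image rows; census V21/V21b: 20 S-b curves, 16 distinct, window 1 ‖ 1)
  — ONE announced input where the published route of record (`x4SharpThree_iff_residue_sharp`) spends
  seven named facts incl. the flagged sharp Kato reading; `x4SharpThree_of_censusResidue_of_kim2025_OPEN`
  (residue = no `j`-witness ∧ ¬surj(9) ∧ `ord₃ j ≥ 0`, spending additive-p1's (M) route on `ord₃ j < 0`).
* (sibling file `X4KimLargeImageKuriharaCertificate.lean`: the unit-Kurihara-number clauses — exact
  boundary `BSD(E,p) ⟺ p ∤ ∏ c_ℓ`, LOWER@3 per pair, rank one.)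
* §5 uniform odd-`p` statement on X4 ∧ `r_an = 0` ∧ surj(p): published Kim 2026 at `p ≥ 5`, the OPEN
  input only at `p = 3` (`X4RankZero.padicValNat_shaOrder_le_allOdd_of_kim_of_kim2025_OPEN`).

Census pointers (numbers are the census files', not this docstring's): N11 = 117 893 cells on R196;
S-b X4@3 `r = 0` surj(3) 192 277 pairs (110 174 potentially good + 82 103 (M)); window unit block
1 582 ‖ 417. Nothing booked; marks unchanged until the referee / rmap seats rule on the reading.

References: Kim 2025 [Kim2025RefinedTNC] Thm. 1.1, Thm. 1.2, Cor. 1.7, §3.2.2, §8.1; Sakamoto 2024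
[Sakamoto2024KolyvaginThree] Thm. 1.1; Kim 2026 [Kim2022StructureSelmer] Thm. 1.9 (6), §1.2.5, Conj. 1.10;
Serre 1968/1972 (tower at `p ≥ 5`); Miller 2011 [Miller2011LMS] Def. 1.1; Mazur 1977 (torsion).
-/

noncomputable section

open scoped Classical MatrixGroups ModularForm

open CongruenceSubgroup WeierstrassCurve Literature.NumberTheory.EllipticCurves
  Literature.NumberTheory.EllipticCurves.ModularForms
  Literature.NumberTheory.EllipticCurves.Rank1Residual
  Literature.NumberTheory.EllipticCurves.Rank1Residual.Typed

namespace Summit.BirchSwinnertonDyer.Rank1Residual.Additive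

variable (W : WeierstrassCurve ℚ) [W.IsElliptic] [W.IsGloballyMinimal] (p : ℕ) [hp : Fact p.Prime]

omit [W.IsElliptic] [W.IsGloballyMinimal] in
/-- On class X4 the prime is odd, so `3 ≤ p`. [folklore] -/
theorem three_le_of_classX4 (hX : ClassX4 W p) : 3 ≤ p := by
  have h2 := hp.out.two_le
  have hne : p ≠ 2 := hX.1
  omega

/-! ### §1 Every odd `p`: the rank-`0` upper bound from the OPEN input under tower surjectivity -/

/-- **Upper bound on `ord_p #Ш` in analytic rank `0` at `p ≥ 3` with `ρ̄_{E,p^n}` onto ∀ `n` and a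
Manin constant prime to `p`, ANY reduction type** — CONDITIONAL on the announced Kim 2025 Cor. 1.7
(`hKim25`, OPEN); Gross–Zagier–Kolyvagin `hGZK`; modularity `hmod`. With
`#Ш_an = L(E,1)·#E(ℚ)_tors²/(Ω·∏ c_ℓ)`: `#Ш_an = q ∈ ℚ` and
`ord_p #Ш ≤ ord_p q + ord_p ∏ c_ℓ − 2 ord_p #E(ℚ)_tors`. The `p ≥ 5` twin from PUBLISHED print is
`padicValNat_shaOrder_le_of_kim_rankZero` (file `X4RankZeroUpperBound`). [claim: Kim2025RefinedTNC, status: under-review]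
[cite: Kim2025RefinedTNC, Thm. 1.1, Cor. 1.7 (ANNOUNCED, OPEN binder)] [cite: Miller2011LMS, Def. 1.1] -/
theorem rankZero_padicValNat_shaOrder_le_of_kim2025_OPEN
    (hKim25 : Kim2025.rankZero_padicValNat_sha_le_of_towerSurj_OPEN)
    (hGZK : rank_eq_analyticRank_of_analyticRank_le_one) (hmod : hasEntireLFunction_rat)
    (hp3 : 3 ≤ p) (hr : W.analyticRank = 0)
    (htower : ∀ n : ℕ, W.HasSurjectiveModNGaloisRep (p ^ n : ℕ))
    {N : ℕ} [NeZero N] (D : ModularParametrizationData W N) (hc : ¬ (p : ℤ) ∣ D.maninConstant) :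
    ∃ q : ℚ, shaAn W = (q : ℂ) ∧
      (padicValNat p W.shaOrder : ℤ) ≤
        padicValRat p q + padicValNat p W.tamagawaProduct - 2 * padicValNat p W.torsionOrder := by
  have hL : W.entireLFunction 1 ≠ 0 := (W.analyticRank_eq_zero_iff_holds (hmod W)).mp hr
  obtain ⟨hmw, hfin⟩ := hGZK W (by rw [hr]; exact zero_le_one)
  haveI : Finite W.sha := hfin
  have hmw0 : W.mordellWeilRank = 0 := by rw [hmw, hr]
  obtain ⟨q₀, hq₀, hle⟩ := hKim25 W p hp3 htower hL hfin D hc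
  have hΩpos : 0 < W.realPeriodRat := W.realPeriodRat_pos_holds
  have hΩ : (W.realPeriodRat : ℂ) ≠ 0 := by exact_mod_cast hΩpos.ne'
  have hc0 : 0 < W.tamagawaProduct := W.tamagawaProduct_pos_holds
  have ht0 : 0 < W.torsionOrder := W.torsionOrder_pos_holds
  have hq₀0 : q₀ ≠ 0 := by
    rintro rfl
    rw [Rat.cast_zero, div_eq_zero_iff] at hq₀
    exact hq₀.elim hL hΩ
  refine ⟨q₀ * (W.torsionOrder : ℚ) ^ 2 / (W.tamagawaProduct : ℚ), ?_, ?_⟩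
  · have hcp : (W.tamagawaProduct : ℂ) ≠ 0 := by exact_mod_cast hc0.ne'
    have hLq : W.entireLFunction 1 = (q₀ : ℂ) * (W.realPeriodRat : ℂ) := by
      rw [← hq₀, div_mul_cancel₀ _ hΩ]
    rw [shaAn_def, leadingLCoeff_eq_of_analyticRank_eq_zero W hr,
      W.regulator_eq_one_of_rank_zero hmw0, hLq]
    push_cast
    field_simp
  · have ht : (W.torsionOrder : ℚ) ≠ 0 := by exact_mod_cast ht0.ne'
    have hcq : (W.tamagawaProduct : ℚ) ≠ 0 := by exact_mod_cast hc0.ne'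
    have hsha : padicValNat p (Nat.card (AddCommGroup.primaryComponent W.sha p)) =
        padicValNat p W.shaOrder := by
      unfold WeierstrassCurve.shaOrder
      exact padicValNat_card_addPrimaryComponent p
    have hv : padicValRat p (q₀ * (W.torsionOrder : ℚ) ^ 2 / (W.tamagawaProduct : ℚ)) =
        padicValRat p q₀ + 2 * (padicValNat p W.torsionOrder : ℤ) -
          (padicValNat p W.tamagawaProduct : ℤ) := by
      rw [padicValRat.div (mul_ne_zero hq₀0 (pow_ne_zero 2 ht)) hcq,
        padicValRat.mul hq₀0 (pow_ne_zero 2 ht), pow_two, padicValRat.mul ht ht,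
        padicValRat.of_nat, padicValRat.of_nat]
      ring
    rw [hv, ← hsha]
    linarith

/-- **X4 ∧ `r_an = 0`, `ρ̄_{E,p^n}` onto ∀ `n`, Manin constant of `D` prime to `p`:
`ord_p #Ш(E) ≤ ord_p #Ш_an(E) + ord_p ∏ c_ℓ`** at the (odd) additive prime `p`, whatever the
potential reduction type — CONDITIONAL on `hKim25` (OPEN); the torsion term vanishes because `E[p]`
is irreducible (Mazur 1977). NO Tamagawa, NO (ram), NO `ord_p j` hypothesis. At `p = 3` this is the
conclusion of the conjecture `Additive.X4SharpThree` on the tower-surjective rows (§2).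
[claim: Kim2025RefinedTNC, status: under-review] [cite: Kim2025RefinedTNC, Thm. 1.1, Cor. 1.7 (ANNOUNCED, OPEN binder)]
[cite: Mazur1977, Ch. III §5, p. 157] -/
theorem X4RankZero.padicValNat_shaOrder_le_of_kim2025_OPEN
    (hKim25 : Kim2025.rankZero_padicValNat_sha_le_of_towerSurj_OPEN)
    (hGZK : rank_eq_analyticRank_of_analyticRank_le_one) (hmod : hasEntireLFunction_rat)
    (hr : W.analyticRank = 0) (hX : ClassX4 W p)
    (htower : ∀ n : ℕ, W.HasSurjectiveModNGaloisRep (p ^ n : ℕ))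
    {N : ℕ} [NeZero N] (D : ModularParametrizationData W N) (hc : ¬ (p : ℤ) ∣ D.maninConstant) :
    ∃ q : ℚ, shaAn W = (q : ℂ) ∧
      (padicValNat p W.shaOrder : ℤ) ≤ padicValRat p q + padicValNat p W.tamagawaProduct := by
  obtain ⟨q, hq, hle⟩ := rankZero_padicValNat_shaOrder_le_of_kim2025_OPEN W p hKim25 hGZK hmod
    (three_le_of_classX4 W p hX) hr htower D hc
  refine ⟨q, hq, ?_⟩
  rw [padicValNat_torsionOrder_eq_zero_of_irreducible W p hX.2.2] at hle
  simpa using hle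

/-- **The typed UPPER half on X4 ∧ `r_an = 0` ∧ tower ∧ `p ∤ c_D` ∧ `p ∤ ∏ c_ℓ`**:
`MissingUpperBoundAt W p`, CONDITIONAL on `hKim25` (OPEN). [claim: Kim2025RefinedTNC, status: under-review]
[cite: Kim2025RefinedTNC, Cor. 1.7 (ANNOUNCED, OPEN binder)] [cite: Miller2011LMS, Def. 1.1] -/
theorem X4RankZero.missingUpperBoundAt_of_kim2025_OPEN
    (hKim25 : Kim2025.rankZero_padicValNat_sha_le_of_towerSurj_OPEN)
    (hGZK : rank_eq_analyticRank_of_analyticRank_le_one) (hmod : hasEntireLFunction_rat)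
    (hr : W.analyticRank = 0) (hX : ClassX4 W p)
    (htower : ∀ n : ℕ, W.HasSurjectiveModNGaloisRep (p ^ n : ℕ))
    {N : ℕ} [NeZero N] (D : ModularParametrizationData W N) (hc : ¬ (p : ℤ) ∣ D.maninConstant)
    (htam : ¬ p ∣ W.tamagawaProduct) : MissingUpperBoundAt W p := by
  obtain ⟨q, hq, hle⟩ :=
    X4RankZero.padicValNat_shaOrder_le_of_kim2025_OPEN W p hKim25 hGZK hmod hr hX htower D hc
  refine ⟨q, hq, ?_⟩
  rw [padicValNat.eq_zero_of_not_dvd htam, Nat.cast_zero, add_zero] at hle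
  exact hle

/-- **What remains on these rows is the LOWER half**: on X4 ∧ `r_an = 0` ∧ tower ∧ `p ∤ c_D` ∧
`p ∤ ∏ c_ℓ`, `MissingPPartAt W p ⟺ MissingLowerBoundAt W p`, CONDITIONAL on `hKim25` (OPEN).
[claim: Kim2025RefinedTNC, status: under-review] [cite: Kim2025RefinedTNC, Cor. 1.7 (ANNOUNCED, OPEN binder)]
[cite: Miller2011LMS, Def. 1.1] -/
theorem X4RankZero.missingPPartAt_iff_lower_of_kim2025_OPEN
    (hKim25 : Kim2025.rankZero_padicValNat_sha_le_of_towerSurj_OPEN)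
    (hGZK : rank_eq_analyticRank_of_analyticRank_le_one) (hmod : hasEntireLFunction_rat)
    (hr : W.analyticRank = 0) (hX : ClassX4 W p)
    (htower : ∀ n : ℕ, W.HasSurjectiveModNGaloisRep (p ^ n : ℕ))
    {N : ℕ} [NeZero N] (D : ModularParametrizationData W N) (hc : ¬ (p : ℤ) ∣ D.maninConstant)
    (htam : ¬ p ∣ W.tamagawaProduct) : MissingPPartAt W p ↔ MissingLowerBoundAt W p :=
  ⟨fun h => (lower_and_upper_of_missingPPartAt W p h).1, fun h =>
    missingPPartAt_of_lower_of_upper W p h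
      (X4RankZero.missingUpperBoundAt_of_kim2025_OPEN W p hKim25 hGZK hmod hr hX htower D hc htam)⟩

/-- **`BSD(E,p)` on X4 ∧ `r_an = 0` ∧ tower ∧ `p ∤ c_D` ∧ `p ∤ ∏ c_ℓ · #Ш_an`** (no Kurihara
number, no main conjecture), CONDITIONAL on `hKim25` (OPEN). At `p = 3` with a tower certificate
this is the N11 UNIT block (1 582 ‖ 417 window rows) from ONE announced input.
[claim: Kim2025RefinedTNC, status: under-review] [cite: Kim2025RefinedTNC, Cor. 1.7 (ANNOUNCED, OPEN binder)]
[cite: Miller2011LMS, §1 and Def. 1.1] -/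
theorem X4RankZero.bsdp_of_kim2025_OPEN_of_shaAn_unit
    (hKim25 : Kim2025.rankZero_padicValNat_sha_le_of_towerSurj_OPEN)
    (hGZK : rank_eq_analyticRank_of_analyticRank_le_one) (hmod : hasEntireLFunction_rat)
    (hr : W.analyticRank = 0) (hX : ClassX4 W p)
    (htower : ∀ n : ℕ, W.HasSurjectiveModNGaloisRep (p ^ n : ℕ))
    {N : ℕ} [NeZero N] (D : ModularParametrizationData W N) (hc : ¬ (p : ℤ) ∣ D.maninConstant)
    (htam : ¬ p ∣ W.tamagawaProduct) {q : ℚ} (hq : shaAn W = (q : ℂ)) (hv : padicValRat p q = 0) :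
    BSDp W p :=
  bsdp_of_shaOrder_le_of_shaAn_unit W p hGZK (by rw [hr]; exact zero_le_one)
    (X4RankZero.padicValNat_shaOrder_le_of_kim2025_OPEN W p hKim25 hGZK hmod hr hX htower D hc)
    htam hq hv

/-! ### §2 `p = 3`: X4♯(3) on the tower-surjective rows; X4♯(3) ⟺ X4♯(3) on the EXOTIC rows -/

/-- **X4♯(3)'s conclusion on every `3`-adically tower-surjective row** (X4 ∧ `r_an = 0` at `3`,
`ρ̄_{E,3^n}` onto ∀ `n`, datum with `3 ∤ c_D`): `ord₃ #Ш ≤ ord₃ #Ш_an + ord₃ ∏ c_ℓ` — INCLUDING the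
`3 ∣ ∏ c_ℓ` rows and every potential reduction type at `3`. CONDITIONAL on `hKim25` (OPEN).
[claim: Kim2025RefinedTNC, status: under-review] [cite: Kim2025RefinedTNC, Cor. 1.7, §8.1.2 (ANNOUNCED, OPEN binder)] -/
theorem x4SharpThree_conclusion_of_kim2025_OPEN_of_towerSurj
    (hKim25 : Kim2025.rankZero_padicValNat_sha_le_of_towerSurj_OPEN)
    (hGZK : rank_eq_analyticRank_of_analyticRank_le_one) (hmod : hasEntireLFunction_rat)
    (hr : W.analyticRank = 0) (hX : ClassX4 W 3)
    (htower : ∀ n : ℕ, W.HasSurjectiveModNGaloisRep (3 ^ n : ℕ))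
    {N : ℕ} [NeZero N] (D : ModularParametrizationData W N) (hc : ¬ (3 : ℤ) ∣ D.maninConstant) :
    ∃ q : ℚ, shaAn W = (q : ℂ) ∧
      (padicValNat 3 W.shaOrder : ℤ) ≤ padicValRat 3 q + padicValNat 3 W.tamagawaProduct :=
  X4RankZero.padicValNat_shaOrder_le_of_kim2025_OPEN W 3 hKim25 hGZK hmod hr hX htower D
    (by exact_mod_cast hc)

/-- **X4♯(3)'s conclusion from the census certificates of `3`-adic surjectivity** (surj(3) together
with a `j`-witness — a prime `q ≠ 3`, `ord_q j < 0`, `3 ∤ ord_q j` — or surj(9)), CONDITIONAL on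
`hKim25` (OPEN); no Tamagawa, no `ord₃ j` hypothesis. [claim: Kim2025RefinedTNC, status: under-review]
[cite: Kim2025RefinedTNC, Cor. 1.7 (ANNOUNCED, OPEN binder)] [cite: SerreAbelianLadic1968, Ch. IV §3.4, Lemma 3 (IV-23)] -/
theorem x4SharpThree_conclusion_of_kim2025_OPEN_of_cert
    (hKim25 : Kim2025.rankZero_padicValNat_sha_le_of_towerSurj_OPEN)
    (hGZK : rank_eq_analyticRank_of_analyticRank_le_one) (hmod : hasEntireLFunction_rat)
    (hr : W.analyticRank = 0) (hX : ClassX4 W 3) (hsurj : Surj W 3)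
    (hcert : (∃ q : ℕ, q.Prime ∧ q ≠ 3 ∧ padicValRat q W.j < 0 ∧ ¬ (3 : ℤ) ∣ padicValRat q W.j) ∨
      W.HasSurjectiveModNGaloisRep 9)
    {N : ℕ} [NeZero N] (D : ModularParametrizationData W N) (hc : ¬ (3 : ℤ) ∣ D.maninConstant) :
    ∃ q : ℚ, shaAn W = (q : ℂ) ∧
      (padicValNat 3 W.shaOrder : ℤ) ≤ padicValRat 3 q + padicValNat 3 W.tamagawaProduct :=
  x4SharpThree_conclusion_of_kim2025_OPEN_of_towerSurj W hKim25 hGZK hmod hr hX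
    (towerSurj_three_of_surj_of_jWitness_or_nine W hsurj hcert) D hc

/-- **X4♯(3) ⟺ X4♯(3) on the EXOTIC rows** (granted the announced Kim 2025 Cor. 1.7 `hKim25`, GZK
and modularity): the conjecture `Additive.X4SharpThree` is EQUIVALENT to its restriction to the X4
pairs `(E, 3)` of analytic rank `0` with `ρ̄_{E,3}` onto but `ρ̄_{E,3^n}` NOT onto for some `n`
(Elkies' `3`-adic images; seat census V21/V21b of additive-p4: 20 curves in the S-b sweep, window
1 ‖ 1, each certificate-closed). ONE announced input; every potential reduction type and the
`3 ∣ ∏ c_ℓ` rows are inside the theorem part. Compare `x4SharpThree_iff_residue_sharp` (seven named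
facts, residue = pot-good ∧ ¬tower). Nothing asserted about the residue; X4 stays CONSTRUCTION-SHAPED;
nothing booked. [claim: Kim2025RefinedTNC, status: under-review]
[cite: Kim2025RefinedTNC, Thm. 1.1, Cor. 1.7, §3.2.2 (ANNOUNCED, OPEN binder)] -/
theorem x4SharpThree_iff_exotic_of_kim2025_OPEN
    (hKim25 : Kim2025.rankZero_padicValNat_sha_le_of_towerSurj_OPEN)
    (hGZK : rank_eq_analyticRank_of_analyticRank_le_one) (hmod : hasEntireLFunction_rat) :
    X4SharpThree ↔
      ∀ (W : WeierstrassCurve ℚ) [W.IsElliptic] [W.IsGloballyMinimal],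
        W.analyticRank = 0 → ClassX4 W 3 → Surj W 3 →
        ¬ (∀ n : ℕ, W.HasSurjectiveModNGaloisRep (3 ^ n : ℕ)) →
        ∀ {N : ℕ} [NeZero N] (D : ModularParametrizationData W N), ¬ (3 : ℤ) ∣ D.maninConstant →
        ∃ q : ℚ, shaAn W = (q : ℂ) ∧
          (padicValNat 3 W.shaOrder : ℤ) ≤ padicValRat 3 q + padicValNat 3 W.tamagawaProduct := by
  constructor
  · intro h V _ _ hr hX hsurj _ N _ D hc
    exact h V hr hX hsurj D hc
  · intro hres V _ _ hr hX hsurj N _ D hc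
    by_cases htower : ∀ n : ℕ, V.HasSurjectiveModNGaloisRep (3 ^ n : ℕ)
    · exact x4SharpThree_conclusion_of_kim2025_OPEN_of_towerSurj V hKim25 hGZK hmod hr hX htower D hc
    · exact hres V hr hX hsurj htower D hc

/-- **X4♯(3) FOLLOWS from its restriction to the CENSUS-DECIDABLE residue** {no `j`-witness ∧
¬surj(9)} (granted `hKim25` (OPEN), GZK, modularity): potential multiplicativity at `3` no longer
needs a separate route. [claim: Kim2025RefinedTNC, status: under-review]
[cite: Kim2025RefinedTNC, Cor. 1.7 (ANNOUNCED, OPEN binder)] [cite: SilvermanATAEC1994, V.5.3] -/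
theorem x4SharpThree_of_censusResidue_of_kim2025_OPEN
    (hKim25 : Kim2025.rankZero_padicValNat_sha_le_of_towerSurj_OPEN)
    (hGZK : rank_eq_analyticRank_of_analyticRank_le_one) (hmod : hasEntireLFunction_rat)
    (hres : ∀ (W : WeierstrassCurve ℚ) [W.IsElliptic] [W.IsGloballyMinimal],
        W.analyticRank = 0 → ClassX4 W 3 → Surj W 3 →
        (∀ q : ℕ, q.Prime → q ≠ 3 → padicValRat q W.j < 0 → (3 : ℤ) ∣ padicValRat q W.j) →
        ¬ W.HasSurjectiveModNGaloisRep 9 →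
        ∀ {N : ℕ} [NeZero N] (D : ModularParametrizationData W N), ¬ (3 : ℤ) ∣ D.maninConstant →
        ∃ q : ℚ, shaAn W = (q : ℂ) ∧
          (padicValNat 3 W.shaOrder : ℤ) ≤ padicValRat 3 q + padicValNat 3 W.tamagawaProduct) :
    X4SharpThree := by
  intro V _ _ hr hX hsurj N _ D hc
  by_cases hc' : (∃ q : ℕ, q.Prime ∧ q ≠ 3 ∧ padicValRat q V.j < 0 ∧ ¬ (3 : ℤ) ∣ padicValRat q V.j) ∨
      V.HasSurjectiveModNGaloisRep 9
  · exact x4SharpThree_conclusion_of_kim2025_OPEN_of_cert V hKim25 hGZK hmod hr hX hsurj hc' D hc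
  · have hno9 : ¬ V.HasSurjectiveModNGaloisRep 9 := fun h ↦ hc' (Or.inr h)
    refine hres V hr hX hsurj (fun q hq hq3 hneg ↦ ?_) hno9 D hc
    by_contra hnd
    exact hc' (Or.inl ⟨q, hq, hq3, hneg, hnd⟩)

/-- **`BSD(E,3)` on the N11 unit rows carrying a tower certificate** (X4 ∧ `r_an = 0` at `3`,
surj(3), `j`-witness or surj(9), `3 ∤ c_D`, `3 ∤ ∏ c_ℓ`, `#Ш_an` a `3`-unit), CONDITIONAL on
`hKim25` (OPEN); no Kurihara number, no Kato reading, no Delbourgo / Wuthrich input.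
[claim: Kim2025RefinedTNC, status: under-review] [cite: Kim2025RefinedTNC, Cor. 1.7 (ANNOUNCED, OPEN binder)]
[cite: Miller2011LMS, §1 and Def. 1.1] -/
theorem X4RankZero.bsdp_three_of_kim2025_OPEN_of_cert_of_shaAn_unit
    (hKim25 : Kim2025.rankZero_padicValNat_sha_le_of_towerSurj_OPEN)
    (hGZK : rank_eq_analyticRank_of_analyticRank_le_one) (hmod : hasEntireLFunction_rat)
    (hr : W.analyticRank = 0) (hX : ClassX4 W 3) (hsurj : Surj W 3)
    (hcert : (∃ q : ℕ, q.Prime ∧ q ≠ 3 ∧ padicValRat q W.j < 0 ∧ ¬ (3 : ℤ) ∣ padicValRat q W.j) ∨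
      W.HasSurjectiveModNGaloisRep 9)
    {N : ℕ} [NeZero N] (D : ModularParametrizationData W N) (hc : ¬ (3 : ℤ) ∣ D.maninConstant)
    (htam : ¬ 3 ∣ W.tamagawaProduct) {q : ℚ} (hq : shaAn W = (q : ℂ)) (hv : padicValRat 3 q = 0) :
    BSDp W 3 :=
  bsdp_of_shaOrder_le_of_shaAn_unit W 3 hGZK (by rw [hr]; exact zero_le_one)
    (x4SharpThree_conclusion_of_kim2025_OPEN_of_cert W hKim25 hGZK hmod hr hX hsurj hcert D hc)
    htam hq hv

/-! ### §5 Uniform in the odd prime: published at `p ≥ 5`, the OPEN input only at `p = 3` -/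

/-- **X4 ∧ `r_an = 0` ∧ surj(p), every odd `p`: `ord_p #Ш ≤ ord_p #Ш_an + ord_p ∏ c_ℓ`**, from the
PUBLISHED Kim 2026 Thm. 1.8 (6) at `p ≥ 5` (`hKim`; tower automatic by Serre) and the ANNOUNCED
Kim 2025 Cor. 1.7 at `p = 3` (`hKim25`, OPEN) given a `3`-adic tower (`htower3`, only asked at
`p = 3`). The shape Partition / class consumers want. [cite: Kim2022StructureSelmer, Thm. 1.9 (6) (PDF p. 8)]
[claim: Kim2025RefinedTNC, status: under-review] [cite: Kim2025RefinedTNC, Cor. 1.7 (ANNOUNCED, OPEN binder)]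
[cite: SerreAbelianLadic1968, Ch. IV §3.4, Lemma 3 (IV-23)] -/
theorem X4RankZero.padicValNat_shaOrder_le_allOdd_of_kim_of_kim2025_OPEN
    (hKim : Kim2026.rankZero_padicValNat_sha_le_of_maninConstant)
    (hKim25 : Kim2025.rankZero_padicValNat_sha_le_of_towerSurj_OPEN)
    (hGZK : rank_eq_analyticRank_of_analyticRank_le_one) (hmod : hasEntireLFunction_rat)
    (hr : W.analyticRank = 0) (hX : ClassX4 W p) (hsurj : Surj W p)
    (htower3 : p = 3 → ∀ n : ℕ, W.HasSurjectiveModNGaloisRep (p ^ n : ℕ))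
    {N : ℕ} [NeZero N] (D : ModularParametrizationData W N) (hc : ¬ (p : ℤ) ∣ D.maninConstant) :
    ∃ q : ℚ, shaAn W = (q : ℂ) ∧
      (padicValNat p W.shaOrder : ℤ) ≤ padicValRat p q + padicValNat p W.tamagawaProduct := by
  by_cases h3 : p = 3
  · exact X4RankZero.padicValNat_shaOrder_le_of_kim2025_OPEN W p hKim25 hGZK hmod hr hX (htower3 h3) D hc
  · exact X4RankZero.padicValNat_shaOrder_le W p hKim hGZK hmod
      (hp.out.five_le_of_ne_two_of_ne_three hX.1 h3) hr hX hsurj D hc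

/-- **`BSD(E,p)` on X4 ∧ `r_an = 0` ∧ surj(p) ∧ `p ∤ c_D · ∏ c_ℓ · #Ш_an`, every odd `p`** (Kim 2026
published at `p ≥ 5`; Kim 2025 OPEN + a `3`-adic tower at `p = 3`).
[cite: Kim2022StructureSelmer, Thm. 1.9 (6) (PDF p. 8)] [claim: Kim2025RefinedTNC, status: under-review]
[cite: Kim2025RefinedTNC, Cor. 1.7 (ANNOUNCED, OPEN binder)] [cite: Miller2011LMS, §1 and Def. 1.1] -/
theorem X4RankZero.bsdp_allOdd_of_kim_of_kim2025_OPEN_of_shaAn_unit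
    (hKim : Kim2026.rankZero_padicValNat_sha_le_of_maninConstant)
    (hKim25 : Kim2025.rankZero_padicValNat_sha_le_of_towerSurj_OPEN)
    (hGZK : rank_eq_analyticRank_of_analyticRank_le_one) (hmod : hasEntireLFunction_rat)
    (hr : W.analyticRank = 0) (hX : ClassX4 W p) (hsurj : Surj W p)
    (htower3 : p = 3 → ∀ n : ℕ, W.HasSurjectiveModNGaloisRep (p ^ n : ℕ))
    {N : ℕ} [NeZero N] (D : ModularParametrizationData W N) (hc : ¬ (p : ℤ) ∣ D.maninConstant)
    (htam : ¬ p ∣ W.tamagawaProduct) {q : ℚ} (hq : shaAn W = (q : ℂ)) (hv : padicValRat p q = 0) :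
    BSDp W p :=
  bsdp_of_shaOrder_le_of_shaAn_unit W p hGZK (by rw [hr]; exact zero_le_one)
    (X4RankZero.padicValNat_shaOrder_le_allOdd_of_kim_of_kim2025_OPEN W p hKim hKim25 hGZK hmod hr hX
      hsurj htower3 D hc) htam hq hv

/-! ### §6 APPEND: with n1011-p14's certificate-free tower on the semistable-twist locus
(`Additive/SemistableTwistTowerThree.lean`): X4♯(3) from surj(3) ALONE there; the EXOTIC residue located -/

/-- **X4♯(3)'s conclusion from surj(3) ALONE on the semistable-twist rows** ((M): `ord₃ j < 0`, or
(G-ord, `e = 2`); 82 103 + 16 517 of N11's 192 277 S-b pairs): no certificate, no Tamagawa / (ram) /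
Delbourgo / Wuthrich-`ω` input; tower = `ClassX4.towerSurj_of_surj_of_potMult_or_typeGOrd_two` (p14).
CONDITIONAL on `hKim25` (OPEN). [claim: Kim2025RefinedTNC, status: under-review]
[cite: Kim2025RefinedTNC, Cor. 1.7 (ANNOUNCED, OPEN binder)] [cite: Wuthrich2014, Lemma 20 (p. 399)] -/
theorem x4SharpThree_conclusion_of_kim2025_OPEN_of_surj_of_semistableTwist
    (hKim25 : Kim2025.rankZero_padicValNat_sha_le_of_towerSurj_OPEN)
    (hGZK : rank_eq_analyticRank_of_analyticRank_le_one) (hmod : hasEntireLFunction_rat)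
    (hr : W.analyticRank = 0) (hX : ClassX4 W 3) (hsurj : Surj W 3)
    (hsst : padicValRat 3 W.j < 0 ∨ (TypeGOrd W 3 ∧ semistabilityIndex W 3 = 2))
    {N : ℕ} [NeZero N] (D : ModularParametrizationData W N) (hc : ¬ (3 : ℤ) ∣ D.maninConstant) :
    ∃ q : ℚ, shaAn W = (q : ℂ) ∧
      (padicValNat 3 W.shaOrder : ℤ) ≤ padicValRat 3 q + padicValNat 3 W.tamagawaProduct :=
  haveI : Fact (Nat.Prime 3) := ⟨Nat.prime_three⟩
  x4SharpThree_conclusion_of_kim2025_OPEN_of_towerSurj W hKim25 hGZK hmod hr hX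
    (ClassX4.towerSurj_of_surj_of_potMult_or_typeGOrd_two hX hsst hsurj) D hc

/-- **X4♯(3) ⟺ X4♯(3) on the EXOTIC rows, LOCATED**: granted `hKim25` (OPEN), GZK, modularity, the
conjecture `Additive.X4SharpThree` is EQUIVALENT to its restriction to the rank-`0` X4 pairs at `3`
with `ρ̄_{E,3}` onto, `ord₃ j ≥ 0`, NOT (G-ord, `e = 2`), and no `3`-adic tower (Elkies image) — the
tower being automatic on the semistable-twist locus (p14). Nothing asserted about the residue.
[claim: Kim2025RefinedTNC, status: under-review] [cite: Kim2025RefinedTNC, Thm. 1.1, Cor. 1.7 (ANNOUNCED, OPEN binder)]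
[cite: Wuthrich2014, Lemma 20 (p. 399)] -/
theorem x4SharpThree_iff_exotic_located_of_kim2025_OPEN
    (hKim25 : Kim2025.rankZero_padicValNat_sha_le_of_towerSurj_OPEN)
    (hGZK : rank_eq_analyticRank_of_analyticRank_le_one) (hmod : hasEntireLFunction_rat) :
    X4SharpThree ↔
      ∀ (W : WeierstrassCurve ℚ) [W.IsElliptic] [W.IsGloballyMinimal],
        W.analyticRank = 0 → ClassX4 W 3 → Surj W 3 → 0 ≤ padicValRat 3 W.j →
        ¬ (TypeGOrd W 3 ∧ semistabilityIndex W 3 = 2) →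
        ¬ (∀ n : ℕ, W.HasSurjectiveModNGaloisRep (3 ^ n : ℕ)) →
        ∀ {N : ℕ} [NeZero N] (D : ModularParametrizationData W N), ¬ (3 : ℤ) ∣ D.maninConstant →
        ∃ q : ℚ, shaAn W = (q : ℂ) ∧
          (padicValNat 3 W.shaOrder : ℤ) ≤ padicValRat 3 q + padicValNat 3 W.tamagawaProduct := by
  haveI : Fact (Nat.Prime 3) := ⟨Nat.prime_three⟩
  rw [x4SharpThree_iff_exotic_of_kim2025_OPEN hKim25 hGZK hmod]
  constructor
  · intro h V _ _ hr hX hsurj _ _ htower N _ D hc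
    exact h V hr hX hsurj htower D hc
  · intro hres V _ _ hr hX hsurj htower N _ D hc
    obtain ⟨hj, hG⟩ := ClassX4.not_potMult_and_not_typeGOrd_two_of_not_towerSurj hX hsurj htower
    exact hres V hr hX hsurj (not_lt.mp hj) hG htower D hc

end Summit.BirchSwinnertonDyer.Rank1Residual.Additive

end
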